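import Summits.QuantumFields.BalabanUV.Beta.FP.NestedStepLawTorusCompositeG
import Summits.QuantumFields.BalabanUV.Beta.FP.NestedStepLawTorusCompositeGen

/-!
# `BalabanUV.Beta.FP.NestedStepLawTorusCompositeGenG` — road «FP» for binder row D1, ROUTE T under RULING R-D1-g52-1 (β1) ∕ R-FP-70: **THE `-G` EDITIONS OF
# #19 §3 (`…_graded_slice`: the tower's generators and the one-shot big comb PINNED, `hPW uP′` discharged) AND OF #19-Gen (`…_graded_gen`: the whole generator
# side — `X W₁ W₂ W′₁ W′₂ C₁ C₂` pinned to the exponential family, `j1 j2 uC` discharged), GENERIC OVER `(Q : StepRows d Lc, K)`** — over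
# `NestedStepLawTorusCompositeG.secondVar_oneShot_nestedStepLaw_torus_composite_graded_G` (the brick inputs `hH₀t hone hId htop` passed THROUGH, displayed)

WHY.  Both landed steps are BRICK-FREE (leaf-06 `TorusCompositeUnimodular.det_bigP_mul_towerGen_ne_zero`, `TorusCompositeFP.torus_uP_exp_tower`,
`TorusCompositeIntertwining.torus_j1∕j2_tower`, `TorusGeneratorIntertwining.torus_uC_exp` read `towerGen ∕ bigP ∕ towerC₁ ∕ evalN` only — the road's census
`LANE/g29/census/token_census_AB.out` class B ∕ free), so their `-G` editions are the landed proofs VERBATIM with the head call re-pointed to the `-G` callee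
and the pins over `compRowsG Lc Q ∕ nestedSliceG Lc Q ∕ K`; the top step stays ABSTRACT (`Q₂₀ τ₂` + `htop`) as in #19-G.  [folklore] composition BY NAME;
no `def`, no `def … : Prop`, nothing cited, 0 sorry.  Rows, legs and namings are HYPOTHESES; nothing of the dictionary ∕ Bałaban's asserted (the presentation
is the row's (β1) ruling, quoted).  No existing file touched.  Instances: rooted = #19 §3 ∕ #19-Gen at `Q := Qstep Lc`, `K ℓ r := bhKStepAt d (toSite r) Lc ℓ`
(as #19-G §2's `example`); sym at `Q := QSym Lc`, `K ℓ _ := bhKStepSh d Lc (Dsh Lc) ℓ` (typed where a consumer wants it — #21-Sym).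

HONEST DEPENDENCY (page 1, mandatory): continuum YM on T⁴ ⇐ BetaPertH ∧ nine spine estimates (0/9 proved); BetaPertH ⇐ (D1) ∧ (D4) ∧ CAP+tail;
G-an2-4 gates asym, D1 and NE2/3/4.  HONEST FRAMING (cell contract, verbatim): «discharging `BetaPertH` makes Bałaban's UV stability UNCONDITIONAL —
a real constructive-QFT result; it is NOT the continuum limit and NOT the Clay problem.»  ABSOLUTE RULE (cell charter, verbatim): «No internally-minted
statement may enter as a cited fact. Every hypothesis is either kernel-proved in this package or a verbatim quotation of a PUBLISHED theorem with page
reference. The manuscript(s) under audit are NOT citable for their own disputed steps — they are the thing under adjudication; programme-internal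
(2001/route/tribunal) claims are never citable.»  0 estimates; 0∕4 row-D1 binders (hW, hR, D1Tel, D1Rep); ROOT M‴ p325680 untouched; NOT (C1), NOT (L2′),
NOT (T-ID), NOT SDF, NOT D1, NOT BetaPertH, NOT continuum, NOT Clay.  Road «FP» OWNER, b2b-balaban-beta-d1-p3 gen 29, 2026-08-24.  No existing file touched.
-/

noncomputable section

namespace Summit.QuantumFields.BalabanUV.Beta.FP.NestedStepLawTorusCompositeGenG

open Matrix
open Literature.MathematicalPhysics.QuantumFieldTheory.Balaban1983to89
open Literature.MathematicalPhysics.QuantumFieldTheory.Balaban1983to89.Beta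
open Literature.MathematicalPhysics.QuantumFieldTheory.Balaban1983to89.Beta.Composition (kkt)
open Literature.MathematicalPhysics.QuantumFieldTheory.Balaban1983to89.Beta.CompositionSingular (effForm flucCov minOp minOpL)
open B5Prop11Plancherel (fine)
open B6Lemma24Torus (pbox mem_pbox)
open AffineAveraging (Site box toSite)
open OneStepResolventKernel (Fib)
open Summit.QuantumFields.BalabanUV.Beta.BorderedHessian (bhKStepAt)
open Summit.QuantumFields.BalabanUV.Beta.D1BFx.LogDetSecondVariation (secondVar)
open Summit.QuantumFields.BalabanUV.Beta.FP.KernelPeriodisationFib (Idx perF perF_apply perZ perZ_apply trF perF_transpose)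
open Summit.QuantumFields.BalabanUV.Beta.FP.TorusCombRows (Res)
open Summit.QuantumFields.BalabanUV.Beta.FP.CompositeWardLetters (compWard_b0 compWard_b1 compWard_b2)
open Summit.QuantumFields.BalabanUV.Beta.FP.RelInvPeriodised (bhKStepAt_translate_invariant)
open Summit.QuantumFields.BalabanUV.Beta.FP.PeriodisedWardOrderZero (bhKStepAt_ff_symm)
open Summit.QuantumFields.BalabanUV.Beta.FP.NestedStepLawTransported (secondVar_nestedFP_eq_zero)
open Summit.QuantumFields.BalabanUV.Beta.FP.NestedStepLawTransportedExpGraded (secondVar_oneShot_nestedStepLaw_expTransported_graded_of_uni)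
open Summit.QuantumFields.BalabanUV.Beta.FP.TorusCompositeObjects (towerTorus towerTorus_apply compRows nestedSlice NParam Qstep combF bigP towerGen)
open Summit.QuantumFields.BalabanUV.Beta.FP.TorusCompositeUnimodular (det_bigP_mul_towerGen_ne_zero)
open Summit.QuantumFields.BalabanUV.Beta.FP.TorusCompositeFP (evalN torus_uP_exp_tower)
open Summit.QuantumFields.BalabanUV.Beta.FP.TorusCompositeIntertwining (towerC₁ torus_j1_tower torus_j2_tower)
open Summit.QuantumFields.BalabanUV.Beta.FP.TorusGeneratorIntertwining (torus_uC_exp)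
open Summit.QuantumFields.BalabanUV.Beta.FP.TorusGaugeCovariance (tgrad)
open Summit.QuantumFields.BalabanUV.Beta.FP.NestedStepLawTorusComposite (secondVar_oneShot_nestedStepLaw_torus_composite_graded_slice)
open Summit.QuantumFields.BalabanUV.Beta.GAN24.FineReadoutCauchyFrame (toSite_mem_range)
open AffineAveraging (unitVec)
open Summit.QuantumFields.BalabanUV.Beta.FP.TorusEffFormComposite (torus_composite_inv_and_eff)
open Summit.QuantumFields.BalabanUV.Beta.FP.RelInvPeriodisedCoarse (det_kkt_smul_form_ne_zero_iff)
open Summit.QuantumFields.BalabanUV.Beta.FP.RelInvPeriodisedCombRows (torus_isUnit_det_kkt_combRows)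
open Summit.QuantumFields.BalabanUV.Beta.FP.RelInvPeriodisedEffFormCoarse (wVH_pos)
open Literature.Probability.LatticeModels (Torus.proj)
open BalabanStepJetsSucc (wVH)
open Finset
open Summit.QuantumFields.BalabanUV.Beta.FP.TorusCompositeObjectsG (StepRows compRowsG nestedSliceG)
open Summit.QuantumFields.BalabanUV.Beta.FP.NestedStepLawTorusCompositeG (secondVar_oneShot_nestedStepLaw_torus_composite_graded_G)
open ExpKernelCalculus (MKer)

variable {d : ℕ}

/-! ## §1 The generators and the one-shot big comb PINNED (`-G` of #19 §3) -/

section SliceG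

variable (M' : Fin (d + 1) → ℕ) [∀ μ, NeZero (M' μ)] (Lc : ℕ) [NeZero Lc] (lev : ℕ → ℕ) (rs : ℕ → (Fin (d + 1) → ℕ)) (n : ℕ)

set_option synthInstance.maxSize 1024 in
/-- [folklore] **`-G` OF #19 §3 `…_graded_slice`**: #19-G §1 with `hW₀ : W₀ = towerGen …`, `hP : P = bigP …`, the one-shot generator jets pinned to the exponential family;
`hPW` by `det_bigP_mul_towerGen_ne_zero`, `uP′` by `torus_uP_exp_tower` (brick-free) — the landed proof with the head call re-pointed. -/
theorem secondVar_oneShot_nestedStepLaw_torus_composite_graded_slice_G (Q : StepRows d Lc) (K : ℕ → (Fin (d + 1) → ℕ) → MKer (d + 1) (Fib d)) (hrs : ∀ k, rs k ∈ box (d + 1) Lc) (hlev : ∀ i, lev i = lev (i + 1) + 1)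
    (hM' : ∀ i, Lc ∣ M' i)
    -- the top step's multiplier index type (abstract; at the instances: (B)'s slot presentation one level above `M′`)
    {κ : Type*} [Fintype κ] [DecidableEq κ]
    -- the composite objects PINNED over the abstract families: finest form `K (lev (n+1)) (rs (n+1))`, rows `compRowsG Lc Q`, nested slice `nestedSliceG Lc Q`
    {H₀ : Matrix (↥(pbox (towerTorus Lc M' (n + 1))) × Fin (d + 1)) (↥(pbox (towerTorus Lc M' (n + 1))) × Fin (d + 1)) ℝ}
    {Q₁₀ : Matrix (↥(pbox M') × Fin (d + 1)) (↥(pbox (towerTorus Lc M' (n + 1))) × Fin (d + 1)) ℝ}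
    {τ₁ : Matrix (NParam Lc (fine Lc M') (fun k => rs (k + 1)) n) (↥(pbox (towerTorus Lc M' (n + 1))) × Fin (d + 1)) ℝ}
    (hH₀ : H₀ = (perF (towerTorus Lc M' (n + 1)) (K (lev (n + 1)) (rs (n + 1)))).submatrix
        (fun b : ↥(pbox (towerTorus Lc M' (n + 1))) × Fin (d + 1) => ((b.1, Sum.inl b.2) : Idx (towerTorus Lc M' (n + 1)) (Fib d)))
        (fun b : ↥(pbox (towerTorus Lc M' (n + 1))) × Fin (d + 1) => ((b.1, Sum.inl b.2) : Idx (towerTorus Lc M' (n + 1)) (Fib d))))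
    (hQ₁₀ : Q₁₀ = compRowsG Lc Q M' lev rs (n + 1))
    (hτ₁ : τ₁ = nestedSliceG Lc Q (fine Lc M') (fun k => lev (k + 1)) (fun k => rs (k + 1)) n)
    -- DISPLAYED BRICK INPUTS (discharged per instance): the finest form block is symmetric; leaf-05's one-step letters (h1)ₖ ∕ (hId)ₖ at every storey
    (hH₀t : H₀ᵀ = H₀)
    (hone : ∀ (k : ℕ) (T : Fin (d + 1) → ℕ) [∀ μ, NeZero (T μ)],
      (kkt ((perF (fine Lc T) (K (lev k) (rs k))).submatrix
            (fun b : ↥(pbox (fine Lc T)) × Fin (d + 1) => ((b.1, Sum.inl b.2) : Idx (fine Lc T) (Fib d)))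
            (fun b : ↥(pbox (fine Lc T)) × Fin (d + 1) => ((b.1, Sum.inl b.2) : Idx (fine Lc T) (Fib d))))
        (fromRows (Q T (lev k) (rs k)) (combF Lc (fine Lc T) (rs k)))).det ≠ 0)
    (hId : ∀ (k : ℕ) (T : Fin (d + 1) → ℕ) [∀ μ, NeZero (T μ)] (r' : Fin (d + 1) → ℕ),
      (effForm ((perF (fine Lc T) (K (lev k) (rs k))).submatrix
            (fun b : ↥(pbox (fine Lc T)) × Fin (d + 1) => ((b.1, Sum.inl b.2) : Idx (fine Lc T) (Fib d)))
            (fun b : ↥(pbox (fine Lc T)) × Fin (d + 1) => ((b.1, Sum.inl b.2) : Idx (fine Lc T) (Fib d))))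
          (fromRows (Q T (lev k) (rs k)) (combF Lc (fine Lc T) (rs k)))).toBlocks₁₁
        = (wVH d Lc (lev k + 1))⁻¹ • (perF T (K (lev k + 1) r')).submatrix
            (fun b : ↥(pbox T) × Fin (d + 1) => ((b.1, Sum.inl b.2) : Idx T (Fib d)))
            (fun b : ↥(pbox T) × Fin (d + 1) => ((b.1, Sum.inl b.2) : Idx T (Fib d))))
    (τ₂ : Matrix (Res (toSite (rs 0)) Lc M') (↥(pbox M') × Fin (d + 1)) ℝ)
    -- the top step's averaging rows ABSTRACT; its comb-sliced KKT non-degeneracy over the form `K (lev 0) (rs 0)` DISPLAYED (`htop`)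
    (Q₂₀ : Matrix κ (↥(pbox M') × Fin (d + 1)) ℝ)
    (htop : (kkt ((perF M' (K (lev 0) (rs 0))).submatrix (fun b : ↥(pbox M') × Fin (d + 1) => ((b.1, Sum.inl b.2) : Idx M' (Fib d)))
        (fun b : ↥(pbox M') × Fin (d + 1) => ((b.1, Sum.inl b.2) : Idx M' (Fib d)))) (fromRows Q₂₀ τ₂)).det ≠ 0)
    -- the tower's generators and the one-shot big comb: FREE matrices of the tower's types in v1 (pinned to leaf-06's `towerGen ∕ bigP` by the (SLICE-m) ∕
    -- (COV-m) suppliers in v1.1; target shape 36f428fe4d8b64c2)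
    {W₀ : Matrix (↥(pbox (towerTorus Lc M' (n + 1))) × Fin (d + 1)) (NParam Lc M' rs (n + 1)) ℝ} (hW₀ : W₀ = towerGen Lc M' rs (n + 1))
    {P : Matrix (NParam Lc M' rs (n + 1)) (↥(pbox (towerTorus Lc M' (n + 1))) × Fin (d + 1)) ℝ} (hP : P = bigP Lc M' rs (fun k => toSite_mem_range (hrs k)) (n + 1))
    -- the displayed jets: form (finest level), composite averaging, the top step's averaging jets, generators, witnesses, composite covariance images
    (H₁ H₂ : Matrix (↥(pbox (towerTorus Lc M' (n + 1))) × Fin (d + 1)) (↥(pbox (towerTorus Lc M' (n + 1))) × Fin (d + 1)) ℝ)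
    (Q₁₁ Q₁₂ : Matrix (↥(pbox M') × Fin (d + 1)) (↥(pbox (towerTorus Lc M' (n + 1))) × Fin (d + 1)) ℝ)
    (Q₂₁ Q₂₂ : Matrix κ (↥(pbox M') × Fin (d + 1)) ℝ)
    (W₁ W₂ : Matrix (↥(pbox (towerTorus Lc M' (n + 1))) × Fin (d + 1)) (NParam Lc M' rs (n + 1)) ℝ)
    (Dbar Db₁ Db₂ : Matrix (↥(pbox M') × Fin (d + 1)) (Res (toSite (rs 0)) Lc M') ℝ)
    (Y₀ Y₁ Y₂ : Matrix κ (NParam Lc M' rs (n + 1)) ℝ)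
    -- the chart transport (exponential currency): generators `X` (finest fields), `X̄` (coarse multipliers); one-shot chart's generator jets; parameter-transport jets
    (X : Matrix (↥(pbox (towerTorus Lc M' (n + 1))) × Fin (d + 1)) (↥(pbox (towerTorus Lc M' (n + 1))) × Fin (d + 1)) ℝ) (Xbar : Matrix κ κ ℝ)
    -- the one-shot generator jets PINNED to the tower's exponential family (leaf-06 `TorusCompositeFP.torus_uP_exp_tower`: parameters `c`, `w`)
    (c : ℝ) (w : (↥(pbox (towerTorus Lc M' (n + 1))) × Fin (d + 1)) → ℝ)
    {W'₁ W'₂ : Matrix (↥(pbox (towerTorus Lc M' (n + 1))) × Fin (d + 1)) (NParam Lc M' rs (n + 1)) ℝ}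
    (hW'₁ : W'₁ = Matrix.of fun (b : (↥(pbox (towerTorus Lc M' (n + 1))) × Fin (d + 1))) (e : NParam Lc M' rs (n + 1)) =>
        -(c * w b * evalN Lc M' rs (n + 1) (fun b' : (↥(pbox (towerTorus Lc M' (n + 1))) × Fin (d + 1)) => (b'.1 : Site (d + 1)) + unitVec b'.2) b e))
    (hW'₂ : W'₂ = Matrix.of fun (b : (↥(pbox (towerTorus Lc M' (n + 1))) × Fin (d + 1))) (e : NParam Lc M' rs (n + 1)) =>
        (c * w b) ^ 2 * evalN Lc M' rs (n + 1) (fun b' : (↥(pbox (towerTorus Lc M' (n + 1))) × Fin (d + 1)) => (b'.1 : Site (d + 1)) + unitVec b'.2) b e)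
    (C₁ C₂ : Matrix (NParam Lc M' rs (n + 1)) (NParam Lc M' rs (n + 1)) ℝ)
    {𝔔₀ 𝔔₁ 𝔔₂ : Matrix κ (↥(pbox (towerTorus Lc M' (n + 1))) × Fin (d + 1)) ℝ}
    (h𝔔₀ : Q₂₀ * Q₁₀ = 𝔔₀) (h𝔔₁ : Q₂₁ * Q₁₀ + Q₂₀ * Q₁₁ = 𝔔₁) (h𝔔₂ : Q₂₂ * Q₁₀ + Q₂₁ * Q₁₁ + (Q₂₁ * Q₁₁ + Q₂₀ * Q₁₂) = 𝔔₂)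
    -- (T-β-m) GRADED: the one-shot literal's composite jets are the graded `X`-conjugated words, NAMED
    {H'₁ H'₂ : Matrix (↥(pbox (towerTorus Lc M' (n + 1))) × Fin (d + 1)) (↥(pbox (towerTorus Lc M' (n + 1))) × Fin (d + 1)) ℝ}
    {𝔔'₁ 𝔔'₂ : Matrix κ (↥(pbox (towerTorus Lc M' (n + 1))) × Fin (d + 1)) ℝ}
    (k1 : -(Xᵀ * H₀) + H₁ + H₀ * X = H'₁)
    (k2 : (X * X)ᵀ * H₀ + (-(Xᵀ * H₁) + -(Xᵀ * H₀ * X)) + ((-(Xᵀ * H₁) + -(Xᵀ * H₀ * X)) + (H₂ + H₁ * X + (H₁ * X + H₀ * (X * X)))) = H'₂)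
    (q1 : Xbar * 𝔔₀ + 𝔔₁ + 𝔔₀ * X = 𝔔'₁)
    (q2 : Xbar * Xbar * 𝔔₀ + (Xbar * 𝔔₁ + Xbar * 𝔔₀ * X) + ((Xbar * 𝔔₁ + Xbar * 𝔔₀ * X) + (𝔔₂ + 𝔔₁ * X + (𝔔₁ * X + 𝔔₀ * (X * X)))) = 𝔔'₂)
    (j1 : -X * W₀ + W₁ = W'₁ + W₀ * C₁) (j2 : X * X * W₀ + (2 : ℝ) • (-X * W₁) + W₂ = W'₂ + (2 : ℝ) • (W'₁ * C₁) + W₀ * C₂)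
    (uC : secondVar (1 : Matrix (NParam Lc M' rs (n + 1)) (NParam Lc M' rs (n + 1)) ℝ) C₁ C₂ = 0)
    -- (INV-m) `h1` and (EFF-m) `h2` follow INSIDE from `hone hId htop` by leaf-05 `TorusEffFormCompositeG.torus_composite_inv_and_eff_G`
    {Γ : Matrix (↥(pbox (towerTorus Lc M' (n + 1))) × Fin (d + 1)) (↥(pbox (towerTorus Lc M' (n + 1))) × Fin (d + 1)) ℝ}
    {I : Matrix (↥(pbox (towerTorus Lc M' (n + 1))) × Fin (d + 1)) ((↥(pbox M') × Fin (d + 1)) ⊕ NParam Lc (fine Lc M') (fun k => rs (k + 1)) n) ℝ}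
    {L : Matrix ((↥(pbox M') × Fin (d + 1)) ⊕ NParam Lc (fine Lc M') (fun k => rs (k + 1)) n) (↥(pbox (towerTorus Lc M' (n + 1))) × Fin (d + 1)) ℝ}
    {S : Matrix ((↥(pbox M') × Fin (d + 1)) ⊕ NParam Lc (fine Lc M') (fun k => rs (k + 1)) n)
      ((↥(pbox M') × Fin (d + 1)) ⊕ NParam Lc (fine Lc M') (fun k => rs (k + 1)) n) ℝ}
    {B : Matrix ((↥(pbox M') × Fin (d + 1)) ⊕ NParam Lc (fine Lc M') (fun k => rs (k + 1)) n) (↥(pbox (towerTorus Lc M' (n + 1))) × Fin (d + 1)) ℝ}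
    (hΓ : flucCov H₀ (fromRows Q₁₀ τ₁) = Γ) (hI : minOp H₀ (fromRows Q₁₀ τ₁) = I) (hL : minOpL H₀ (fromRows Q₁₀ τ₁) = L) (hS : effForm H₀ (fromRows Q₁₀ τ₁) = S)
    (hB : fromRows Q₁₁ (0 : Matrix (NParam Lc (fine Lc M') (fun k => rs (k + 1)) n) (↥(pbox (towerTorus Lc M' (n + 1))) × Fin (d + 1)) ℝ) = B)
    -- (SLICE-m) the two Faddeev–Popov pairings are non-degenerate; the one-shot chart's (UNI)-jet letter; the nested chart's dead rows
    -- (SLICE-m) `hPW` and `uP'` DISCHARGED (leaf-06 `TorusCompositeUnimodular.det_bigP_mul_towerGen_ne_zero`, `TorusCompositeFP.torus_uP_exp_tower`)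
    (hTW : (fromRows (τ₂ * Q₁₀) τ₁ * W₀).det ≠ 0) (s1 : τ₁ * W₁ = 0) (s2 : τ₁ * W₂ = 0)
    (t1 : τ₂ * (Q₁₁ * W₀ + Q₁₀ * W₁) = 0) (t2 : τ₂ * (Q₁₂ * W₀ + (2 : ℝ) • (Q₁₁ * W₁) + Q₁₀ * W₂) = 0)
    -- parities of the displayed form jets; the GRADED Ward rows of the finest form against the composite witnesses (NO transposed rows)
    (hH₁t : H₁ᵀ = -H₁) (hH₂t : H₂ᵀ = H₂)
    (a0 : H₀ * W₀ = 𝔔₀ᵀ * Y₀) (a1 : H₁ * W₀ + H₀ * W₁ = -(𝔔₁ᵀ * Y₀) + 𝔔₀ᵀ * Y₁)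
    (a2 : H₂ * W₀ + (2 : ℝ) • (H₁ * W₁) + H₀ * W₂ = 𝔔₂ᵀ * Y₀ + -((2 : ℝ) • (𝔔₁ᵀ * Y₁)) + 𝔔₀ᵀ * Y₂)
    -- (COV-m) the composite covariance rows (orders 0, 1, 2) and the top step's coarse covariance rows
    (c0 : Q₁₀ * W₀ = fromCols Dbar (0 : Matrix (↥(pbox M') × Fin (d + 1)) (NParam Lc (fine Lc M') (fun k => rs (k + 1)) n) ℝ))
    (c1 : Q₁₁ * W₀ + Q₁₀ * W₁ = fromCols Db₁ (0 : Matrix (↥(pbox M') × Fin (d + 1)) (NParam Lc (fine Lc M') (fun k => rs (k + 1)) n) ℝ))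
    (c2 : Q₁₂ * W₀ + (2 : ℝ) • (Q₁₁ * W₁) + Q₁₀ * W₂ = fromCols Db₂ (0 : Matrix (↥(pbox M') × Fin (d + 1)) (NParam Lc (fine Lc M') (fun k => rs (k + 1)) n) ℝ))
    (d0 : Q₂₀ * Dbar = 0) (d1 : Q₂₁ * Dbar + Q₂₀ * Db₁ = 0) (d2 : Q₂₂ * Dbar + (2 : ℝ) • (Q₂₁ * Db₁) + Q₂₀ * Db₂ = 0) :
    secondVar (kkt H₀ (fromRows 𝔔₀ P))
        (fromBlocks H'₁ (-(fromRows 𝔔'₁ (0 : Matrix (NParam Lc M' rs (n + 1)) (↥(pbox (towerTorus Lc M' (n + 1))) × Fin (d + 1)) ℝ))ᵀ)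
          (fromRows 𝔔'₁ (0 : Matrix (NParam Lc M' rs (n + 1)) (↥(pbox (towerTorus Lc M' (n + 1))) × Fin (d + 1)) ℝ)) 0)
        (kkt H'₂ (fromRows 𝔔'₂ (0 : Matrix (NParam Lc M' rs (n + 1)) (↥(pbox (towerTorus Lc M' (n + 1))) × Fin (d + 1)) ℝ)))
      = secondVar (kkt H₀ (fromRows Q₁₀ τ₁)) (fromBlocks H₁ (-Bᵀ) B 0)
            (kkt H₂ (fromRows Q₁₂ (0 : Matrix (NParam Lc (fine Lc M') (fun k => rs (k + 1)) n) (↥(pbox (towerTorus Lc M' (n + 1))) × Fin (d + 1)) ℝ)))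
        + secondVar
            (kkt S.toBlocks₁₁ (fromRows Q₂₀ τ₂))
            (fromBlocks ((L * H₁ - S * B) * I + L * Bᵀ * S).toBlocks₁₁ (-(fromRows Q₂₁ (0 : Matrix (Res (toSite (rs 0)) Lc M') (↥(pbox M') × Fin (d + 1)) ℝ))ᵀ)
              (fromRows Q₂₁ (0 : Matrix (Res (toSite (rs 0)) Lc M') (↥(pbox M') × Fin (d + 1)) ℝ)) 0)
            (kkt (((-((L * H₁ - S * B) * Γ - L * Bᵀ * L) * H₁ + L * H₂
                      - (((L * H₁ - S * B) * I + L * Bᵀ * S) * B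
                          + S * fromRows Q₁₂ (0 : Matrix (NParam Lc (fine Lc M') (fun k => rs (k + 1)) n) (↥(pbox (towerTorus Lc M' (n + 1))) × Fin (d + 1)) ℝ))) * I
                    + (L * H₁ - S * B) * (-((Γ * H₁ + I * B) * I + Γ * Bᵀ * S)))
                  - ((-((L * H₁ - S * B) * Γ - L * Bᵀ * L) * (-Bᵀ)
                        + L * (fromRows Q₁₂ (0 : Matrix (NParam Lc (fine Lc M') (fun k => rs (k + 1)) n) (↥(pbox (towerTorus Lc M' (n + 1))) × Fin (d + 1)) ℝ))ᵀ) * S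
                      + L * (-Bᵀ) * ((L * H₁ - S * B) * I + L * Bᵀ * S))).toBlocks₁₁
              (fromRows Q₂₂ (0 : Matrix (Res (toSite (rs 0)) Lc M') (↥(pbox M') × Fin (d + 1)) ℝ))) :=
  secondVar_oneShot_nestedStepLaw_torus_composite_graded_G M' Lc lev rs n Q K hlev (hH₀ := hH₀) (hQ₁₀ := hQ₁₀) (hτ₁ := hτ₁) (hH₀t := hH₀t) (hone := hone) (hId := hId) (τ₂ := τ₂) (Q₂₀ := Q₂₀) (htop := htop) W₀ P H₁ H₂ Q₁₁ Q₁₂ Q₂₁ Q₂₂ W₁ W₂ Dbar Db₁ Db₂ Y₀ Y₁ Y₂ X Xbar W'₁ W'₂ C₁ C₂ h𝔔₀ h𝔔₁ h𝔔₂ k1 k2 q1 q2 j1 j2 uC hΓ hI hL hS hB (by rw [hP, hW₀]; exact det_bigP_mul_towerGen_ne_zero Lc M' rs _ hM' (n + 1)) hTW (by rw [hP, hW₀, hW'₁, hW'₂]; exact torus_uP_exp_tower Lc M' rs _ hM' (n + 1) c w rfl rfl) s1 s2 t1 t2 hH₁t hH₂t a0 a1 a2 c0 c1 c2 d0 d1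 d2


end SliceG

/-! ## §2 The whole generator side discharged (`-G` of #19-Gen) -/

section GenG

variable (M' : Fin (d + 1) → ℕ) [∀ μ, NeZero (M' μ)] (Lc : ℕ) [NeZero Lc] (lev : ℕ → ℕ) (rs : ℕ → (Fin (d + 1) → ℕ)) (n : ℕ)

set_option synthInstance.maxSize 1024 in
/-- [folklore] **`-G` OF #19-Gen `…_graded_gen`**: §1 with `X W₁ W₂ W′₁ W′₂ C₁ C₂` PINNED to the exponential family and `j1 j2 uC` discharged by leaf-06's
`torus_j1_tower ∕ torus_j2_tower ∕ torus_uC_exp` (brick-free) — the landed proof with the head call re-pointed. -/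
theorem secondVar_oneShot_nestedStepLaw_torus_composite_graded_gen_G (Q : StepRows d Lc) (K : ℕ → (Fin (d + 1) → ℕ) → MKer (d + 1) (Fib d)) (hrs : ∀ k, rs k ∈ box (d + 1) Lc) (hlev : ∀ i, lev i = lev (i + 1) + 1)
    (hM' : ∀ i, Lc ∣ M' i)
    -- the top step's multiplier index type (abstract; at the instances: (B)'s slot presentation one level above `M′`)
    {κ : Type*} [Fintype κ] [DecidableEq κ]
    -- the composite objects PINNED over the abstract families: finest form `K (lev (n+1)) (rs (n+1))`, rows `compRowsG Lc Q`, nested slice `nestedSliceG Lc Q`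
    {H₀ : Matrix (↥(pbox (towerTorus Lc M' (n + 1))) × Fin (d + 1)) (↥(pbox (towerTorus Lc M' (n + 1))) × Fin (d + 1)) ℝ}
    {Q₁₀ : Matrix (↥(pbox M') × Fin (d + 1)) (↥(pbox (towerTorus Lc M' (n + 1))) × Fin (d + 1)) ℝ}
    {τ₁ : Matrix (NParam Lc (fine Lc M') (fun k => rs (k + 1)) n) (↥(pbox (towerTorus Lc M' (n + 1))) × Fin (d + 1)) ℝ}
    (hH₀ : H₀ = (perF (towerTorus Lc M' (n + 1)) (K (lev (n + 1)) (rs (n + 1)))).submatrix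
        (fun b : ↥(pbox (towerTorus Lc M' (n + 1))) × Fin (d + 1) => ((b.1, Sum.inl b.2) : Idx (towerTorus Lc M' (n + 1)) (Fib d)))
        (fun b : ↥(pbox (towerTorus Lc M' (n + 1))) × Fin (d + 1) => ((b.1, Sum.inl b.2) : Idx (towerTorus Lc M' (n + 1)) (Fib d))))
    (hQ₁₀ : Q₁₀ = compRowsG Lc Q M' lev rs (n + 1))
    (hτ₁ : τ₁ = nestedSliceG Lc Q (fine Lc M') (fun k => lev (k + 1)) (fun k => rs (k + 1)) n)
    -- DISPLAYED BRICK INPUTS (discharged per instance): the finest form block is symmetric; leaf-05's one-step letters (h1)ₖ ∕ (hId)ₖ at every storey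
    (hH₀t : H₀ᵀ = H₀)
    (hone : ∀ (k : ℕ) (T : Fin (d + 1) → ℕ) [∀ μ, NeZero (T μ)],
      (kkt ((perF (fine Lc T) (K (lev k) (rs k))).submatrix
            (fun b : ↥(pbox (fine Lc T)) × Fin (d + 1) => ((b.1, Sum.inl b.2) : Idx (fine Lc T) (Fib d)))
            (fun b : ↥(pbox (fine Lc T)) × Fin (d + 1) => ((b.1, Sum.inl b.2) : Idx (fine Lc T) (Fib d))))
        (fromRows (Q T (lev k) (rs k)) (combF Lc (fine Lc T) (rs k)))).det ≠ 0)
    (hId : ∀ (k : ℕ) (T : Fin (d + 1) → ℕ) [∀ μ, NeZero (T μ)] (r' : Fin (d + 1) → ℕ),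
      (effForm ((perF (fine Lc T) (K (lev k) (rs k))).submatrix
            (fun b : ↥(pbox (fine Lc T)) × Fin (d + 1) => ((b.1, Sum.inl b.2) : Idx (fine Lc T) (Fib d)))
            (fun b : ↥(pbox (fine Lc T)) × Fin (d + 1) => ((b.1, Sum.inl b.2) : Idx (fine Lc T) (Fib d))))
          (fromRows (Q T (lev k) (rs k)) (combF Lc (fine Lc T) (rs k)))).toBlocks₁₁
        = (wVH d Lc (lev k + 1))⁻¹ • (perF T (K (lev k + 1) r')).submatrix
            (fun b : ↥(pbox T) × Fin (d + 1) => ((b.1, Sum.inl b.2) : Idx T (Fib d)))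
            (fun b : ↥(pbox T) × Fin (d + 1) => ((b.1, Sum.inl b.2) : Idx T (Fib d))))
    (τ₂ : Matrix (Res (toSite (rs 0)) Lc M') (↥(pbox M') × Fin (d + 1)) ℝ)
    -- the top step's averaging rows ABSTRACT; its comb-sliced KKT non-degeneracy over the form `K (lev 0) (rs 0)` DISPLAYED (`htop`)
    (Q₂₀ : Matrix κ (↥(pbox M') × Fin (d + 1)) ℝ)
    (htop : (kkt ((perF M' (K (lev 0) (rs 0))).submatrix (fun b : ↥(pbox M') × Fin (d + 1) => ((b.1, Sum.inl b.2) : Idx M' (Fib d)))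
        (fun b : ↥(pbox M') × Fin (d + 1) => ((b.1, Sum.inl b.2) : Idx M' (Fib d)))) (fromRows Q₂₀ τ₂)).det ≠ 0)
    -- the tower's generators and the one-shot big comb: FREE matrices of the tower's types in v1 (pinned to leaf-06's `towerGen ∕ bigP` by the (SLICE-m) ∕
    -- (COV-m) suppliers in v1.1; target shape 36f428fe4d8b64c2)
    {W₀ : Matrix (↥(pbox (towerTorus Lc M' (n + 1))) × Fin (d + 1)) (NParam Lc M' rs (n + 1)) ℝ} (hW₀ : W₀ = towerGen Lc M' rs (n + 1))
    {P : Matrix (NParam Lc M' rs (n + 1)) (↥(pbox (towerTorus Lc M' (n + 1))) × Fin (d + 1)) ℝ} (hP : P = bigP Lc M' rs (fun k => toSite_mem_range (hrs k)) (n + 1))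
    -- the displayed jets: form (finest level), composite averaging, the top step's averaging jets, generators, witnesses, composite covariance images
    (H₁ H₂ : Matrix (↥(pbox (towerTorus Lc M' (n + 1))) × Fin (d + 1)) (↥(pbox (towerTorus Lc M' (n + 1))) × Fin (d + 1)) ℝ)
    (Q₁₁ Q₁₂ : Matrix (↥(pbox M') × Fin (d + 1)) (↥(pbox (towerTorus Lc M' (n + 1))) × Fin (d + 1)) ℝ)
    (Q₂₁ Q₂₂ : Matrix κ (↥(pbox M') × Fin (d + 1)) ℝ)
    -- the finest-level transport generator `X = −c·diag(λ)`, the tower's generator jets `W₁ W₂` (weight `h`) and the one-shot generator jets `W′₁ W′₂`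
    -- (weight `h + Dλ`) PINNED to the exponential closed forms of leaf-06's `TorusCompositeIntertwining` ∕ `TorusCompositeFP` (parameters `λ`, `c`, `h`)
    (lam : ↥(pbox (towerTorus Lc M' (n + 1))) → ℝ) (c : ℝ) (h : (↥(pbox (towerTorus Lc M' (n + 1))) × Fin (d + 1)) → ℝ)
    {W₁ W₂ : Matrix (↥(pbox (towerTorus Lc M' (n + 1))) × Fin (d + 1)) (NParam Lc M' rs (n + 1)) ℝ}
    (hW₁ : W₁ = Matrix.of fun (b : (↥(pbox (towerTorus Lc M' (n + 1))) × Fin (d + 1))) (e : NParam Lc M' rs (n + 1)) => -(c * h b * evalN Lc M' rs (n + 1) (fun b' : (↥(pbox (towerTorus Lc M' (n + 1))) × Fin (d + 1)) => (b'.1 : Site (d + 1)) + unitVec b'.2) b e))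
    (hW₂ : W₂ = Matrix.of fun (b : (↥(pbox (towerTorus Lc M' (n + 1))) × Fin (d + 1))) (e : NParam Lc M' rs (n + 1)) => (c * h b) ^ 2 * evalN Lc M' rs (n + 1) (fun b' : (↥(pbox (towerTorus Lc M' (n + 1))) × Fin (d + 1)) => (b'.1 : Site (d + 1)) + unitVec b'.2) b e)
    (Dbar Db₁ Db₂ : Matrix (↥(pbox M') × Fin (d + 1)) (Res (toSite (rs 0)) Lc M') ℝ)
    (Y₀ Y₁ Y₂ : Matrix κ (NParam Lc M' rs (n + 1)) ℝ)
    -- the chart transport (exponential currency): generators `X` (finest fields), `X̄` (coarse multipliers); one-shot chart's generator jets; parameter-transport jets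
    {X : Matrix (↥(pbox (towerTorus Lc M' (n + 1))) × Fin (d + 1)) (↥(pbox (towerTorus Lc M' (n + 1))) × Fin (d + 1)) ℝ} (hX : X = -(c • Matrix.diagonal (fun b : (↥(pbox (towerTorus Lc M' (n + 1))) × Fin (d + 1)) => lam b.1))) (Xbar : Matrix κ κ ℝ)
    {W'₁ W'₂ : Matrix (↥(pbox (towerTorus Lc M' (n + 1))) × Fin (d + 1)) (NParam Lc M' rs (n + 1)) ℝ}
    (hW'₁ : W'₁ = Matrix.of fun (b : (↥(pbox (towerTorus Lc M' (n + 1))) × Fin (d + 1))) (e : NParam Lc M' rs (n + 1)) =>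
        -(c * (h b + ∑ s, tgrad (towerTorus Lc M' (n + 1)) (b.1, Sum.inl b.2) s * lam s) * evalN Lc M' rs (n + 1) (fun b' : (↥(pbox (towerTorus Lc M' (n + 1))) × Fin (d + 1)) => (b'.1 : Site (d + 1)) + unitVec b'.2) b e))
    (hW'₂ : W'₂ = Matrix.of fun (b : (↥(pbox (towerTorus Lc M' (n + 1))) × Fin (d + 1))) (e : NParam Lc M' rs (n + 1)) =>
        (c * (h b + ∑ s, tgrad (towerTorus Lc M' (n + 1)) (b.1, Sum.inl b.2) s * lam s)) ^ 2 * evalN Lc M' rs (n + 1) (fun b' : (↥(pbox (towerTorus Lc M' (n + 1))) × Fin (d + 1)) => (b'.1 : Site (d + 1)) + unitVec b'.2) b e)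
    {C₁ C₂ : Matrix (NParam Lc M' rs (n + 1)) (NParam Lc M' rs (n + 1)) ℝ} (hC₁ : C₁ = c • towerC₁ Lc M' rs (fun k => toSite_mem_range (hrs k)) (n + 1) lam) (hC₂ : C₂ = C₁ * C₁)
    {𝔔₀ 𝔔₁ 𝔔₂ : Matrix κ (↥(pbox (towerTorus Lc M' (n + 1))) × Fin (d + 1)) ℝ}
    (h𝔔₀ : Q₂₀ * Q₁₀ = 𝔔₀) (h𝔔₁ : Q₂₁ * Q₁₀ + Q₂₀ * Q₁₁ = 𝔔₁) (h𝔔₂ : Q₂₂ * Q₁₀ + Q₂₁ * Q₁₁ + (Q₂₁ * Q₁₁ + Q₂₀ * Q₁₂) = 𝔔₂)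
    -- (T-β-m) GRADED: the one-shot literal's composite jets are the graded `X`-conjugated words, NAMED
    {H'₁ H'₂ : Matrix (↥(pbox (towerTorus Lc M' (n + 1))) × Fin (d + 1)) (↥(pbox (towerTorus Lc M' (n + 1))) × Fin (d + 1)) ℝ}
    {𝔔'₁ 𝔔'₂ : Matrix κ (↥(pbox (towerTorus Lc M' (n + 1))) × Fin (d + 1)) ℝ}
    (k1 : -(Xᵀ * H₀) + H₁ + H₀ * X = H'₁)
    (k2 : (X * X)ᵀ * H₀ + (-(Xᵀ * H₁) + -(Xᵀ * H₀ * X)) + ((-(Xᵀ * H₁) + -(Xᵀ * H₀ * X)) + (H₂ + H₁ * X + (H₁ * X + H₀ * (X * X)))) = H'₂)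
    (q1 : Xbar * 𝔔₀ + 𝔔₁ + 𝔔₀ * X = 𝔔'₁)
    (q2 : Xbar * Xbar * 𝔔₀ + (Xbar * 𝔔₁ + Xbar * 𝔔₀ * X) + ((Xbar * 𝔔₁ + Xbar * 𝔔₀ * X) + (𝔔₂ + 𝔔₁ * X + (𝔔₁ * X + 𝔔₀ * (X * X)))) = 𝔔'₂)
    -- (T-β-4) `j1 j2 uC` DISCHARGED (leaf-06 `TorusCompositeIntertwining.torus_j1_tower ∕ torus_j2_tower`, `TorusGeneratorIntertwining.torus_uC_exp`)
    -- (INV-m) `h1` and (EFF-m) `h2` follow INSIDE from `hone hId htop` by leaf-05 `TorusEffFormCompositeG.torus_composite_inv_and_eff_G`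
    {Γ : Matrix (↥(pbox (towerTorus Lc M' (n + 1))) × Fin (d + 1)) (↥(pbox (towerTorus Lc M' (n + 1))) × Fin (d + 1)) ℝ}
    {I : Matrix (↥(pbox (towerTorus Lc M' (n + 1))) × Fin (d + 1)) ((↥(pbox M') × Fin (d + 1)) ⊕ NParam Lc (fine Lc M') (fun k => rs (k + 1)) n) ℝ}
    {L : Matrix ((↥(pbox M') × Fin (d + 1)) ⊕ NParam Lc (fine Lc M') (fun k => rs (k + 1)) n) (↥(pbox (towerTorus Lc M' (n + 1))) × Fin (d + 1)) ℝ}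
    {S : Matrix ((↥(pbox M') × Fin (d + 1)) ⊕ NParam Lc (fine Lc M') (fun k => rs (k + 1)) n)
      ((↥(pbox M') × Fin (d + 1)) ⊕ NParam Lc (fine Lc M') (fun k => rs (k + 1)) n) ℝ}
    {B : Matrix ((↥(pbox M') × Fin (d + 1)) ⊕ NParam Lc (fine Lc M') (fun k => rs (k + 1)) n) (↥(pbox (towerTorus Lc M' (n + 1))) × Fin (d + 1)) ℝ}
    (hΓ : flucCov H₀ (fromRows Q₁₀ τ₁) = Γ) (hI : minOp H₀ (fromRows Q₁₀ τ₁) = I) (hL : minOpL H₀ (fromRows Q₁₀ τ₁) = L) (hS : effForm H₀ (fromRows Q₁₀ τ₁) = S)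
    (hB : fromRows Q₁₁ (0 : Matrix (NParam Lc (fine Lc M') (fun k => rs (k + 1)) n) (↥(pbox (towerTorus Lc M' (n + 1))) × Fin (d + 1)) ℝ) = B)
    -- (SLICE-m) the two Faddeev–Popov pairings are non-degenerate; the one-shot chart's (UNI)-jet letter; the nested chart's dead rows
    -- (SLICE-m) `hPW` and `uP'` DISCHARGED (leaf-06 `TorusCompositeUnimodular.det_bigP_mul_towerGen_ne_zero`, `TorusCompositeFP.torus_uP_exp_tower`)
    (hTW : (fromRows (τ₂ * Q₁₀) τ₁ * W₀).det ≠ 0) (s1 : τ₁ * W₁ = 0) (s2 : τ₁ * W₂ = 0)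
    (t1 : τ₂ * (Q₁₁ * W₀ + Q₁₀ * W₁) = 0) (t2 : τ₂ * (Q₁₂ * W₀ + (2 : ℝ) • (Q₁₁ * W₁) + Q₁₀ * W₂) = 0)
    -- parities of the displayed form jets; the GRADED Ward rows of the finest form against the composite witnesses (NO transposed rows)
    (hH₁t : H₁ᵀ = -H₁) (hH₂t : H₂ᵀ = H₂)
    (a0 : H₀ * W₀ = 𝔔₀ᵀ * Y₀) (a1 : H₁ * W₀ + H₀ * W₁ = -(𝔔₁ᵀ * Y₀) + 𝔔₀ᵀ * Y₁)
    (a2 : H₂ * W₀ + (2 : ℝ) • (H₁ * W₁) + H₀ * W₂ = 𝔔₂ᵀ * Y₀ + -((2 : ℝ) • (𝔔₁ᵀ * Y₁)) + 𝔔₀ᵀ * Y₂)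
    -- (COV-m) the composite covariance rows (orders 0, 1, 2) and the top step's coarse covariance rows
    (c0 : Q₁₀ * W₀ = fromCols Dbar (0 : Matrix (↥(pbox M') × Fin (d + 1)) (NParam Lc (fine Lc M') (fun k => rs (k + 1)) n) ℝ))
    (c1 : Q₁₁ * W₀ + Q₁₀ * W₁ = fromCols Db₁ (0 : Matrix (↥(pbox M') × Fin (d + 1)) (NParam Lc (fine Lc M') (fun k => rs (k + 1)) n) ℝ))
    (c2 : Q₁₂ * W₀ + (2 : ℝ) • (Q₁₁ * W₁) + Q₁₀ * W₂ = fromCols Db₂ (0 : Matrix (↥(pbox M') × Fin (d + 1)) (NParam Lc (fine Lc M') (fun k => rs (k + 1)) n) ℝ))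
    (d0 : Q₂₀ * Dbar = 0) (d1 : Q₂₁ * Dbar + Q₂₀ * Db₁ = 0) (d2 : Q₂₂ * Dbar + (2 : ℝ) • (Q₂₁ * Db₁) + Q₂₀ * Db₂ = 0) :
    secondVar (kkt H₀ (fromRows 𝔔₀ P))
        (fromBlocks H'₁ (-(fromRows 𝔔'₁ (0 : Matrix (NParam Lc M' rs (n + 1)) (↥(pbox (towerTorus Lc M' (n + 1))) × Fin (d + 1)) ℝ))ᵀ)
          (fromRows 𝔔'₁ (0 : Matrix (NParam Lc M' rs (n + 1)) (↥(pbox (towerTorus Lc M' (n + 1))) × Fin (d + 1)) ℝ)) 0)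
        (kkt H'₂ (fromRows 𝔔'₂ (0 : Matrix (NParam Lc M' rs (n + 1)) (↥(pbox (towerTorus Lc M' (n + 1))) × Fin (d + 1)) ℝ)))
      = secondVar (kkt H₀ (fromRows Q₁₀ τ₁)) (fromBlocks H₁ (-Bᵀ) B 0)
            (kkt H₂ (fromRows Q₁₂ (0 : Matrix (NParam Lc (fine Lc M') (fun k => rs (k + 1)) n) (↥(pbox (towerTorus Lc M' (n + 1))) × Fin (d + 1)) ℝ)))
        + secondVar
            (kkt S.toBlocks₁₁ (fromRows Q₂₀ τ₂))
            (fromBlocks ((L * H₁ - S * B) * I + L * Bᵀ * S).toBlocks₁₁ (-(fromRows Q₂₁ (0 : Matrix (Res (toSite (rs 0)) Lc M') (↥(pbox M') × Fin (d + 1)) ℝ))ᵀ)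
              (fromRows Q₂₁ (0 : Matrix (Res (toSite (rs 0)) Lc M') (↥(pbox M') × Fin (d + 1)) ℝ)) 0)
            (kkt (((-((L * H₁ - S * B) * Γ - L * Bᵀ * L) * H₁ + L * H₂
                      - (((L * H₁ - S * B) * I + L * Bᵀ * S) * B
                          + S * fromRows Q₁₂ (0 : Matrix (NParam Lc (fine Lc M') (fun k => rs (k + 1)) n) (↥(pbox (towerTorus Lc M' (n + 1))) × Fin (d + 1)) ℝ))) * I
                    + (L * H₁ - S * B) * (-((Γ * H₁ + I * B) * I + Γ * Bᵀ * S)))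
                  - ((-((L * H₁ - S * B) * Γ - L * Bᵀ * L) * (-Bᵀ)
                        + L * (fromRows Q₁₂ (0 : Matrix (NParam Lc (fine Lc M') (fun k => rs (k + 1)) n) (↥(pbox (towerTorus Lc M' (n + 1))) × Fin (d + 1)) ℝ))ᵀ) * S
                      + L * (-Bᵀ) * ((L * H₁ - S * B) * I + L * Bᵀ * S))).toBlocks₁₁
              (fromRows Q₂₂ (0 : Matrix (Res (toSite (rs 0)) Lc M') (↥(pbox M') × Fin (d + 1)) ℝ))) :=
  secondVar_oneShot_nestedStepLaw_torus_composite_graded_slice_G M' Lc lev rs n Q K hrs hlev hM' (hH₀ := hH₀) (hQ₁₀ := hQ₁₀) (hτ₁ := hτ₁) (hH₀t := hH₀t) (hone := hone) (hId := hId) (τ₂ := τ₂) (Q₂₀ := Q₂₀) (htop := htop) hW₀ hP H₁ H₂ Q₁₁ Q₁₂ Q₂₁ Q₂₂ W₁ W₂ Dbar Db₁ Db₂ Y₀ Y₁ Y₂ X Xbar c (fun b : (↥(pbox (towerTorus Lc M' (n + 1))) × Fin (d + 1)) => (h b + ∑ s, tgrad (towerTorus Lc M' (n + 1)) (b.1,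 Sum.inl b.2) s * lam s)) hW'₁ hW'₂ C₁ C₂ h𝔔₀ h𝔔₁ h𝔔₂ k1 k2 q1 q2 (by rw [hW₀, hC₁]; exact torus_j1_tower Lc M' rs _ (n + 1) lam c h hX hW₁ hW'₁) (by rw [hW₀, hC₂, hC₁]; exact torus_j2_tower Lc M' rs _ (n + 1) lam c h hX hW₁ hW'₁ hW₂ hW'₂) (by rw [hC₂, hC₁]; exact torus_uC_exp c _) hΓ hI hL hS hB hTW s1 s2 t1 t2 hH₁t hH₂t a0 a1 a2 c0 c1 c2 d0 d1 d2


end GenG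

end Summit.QuantumFields.BalabanUV.Beta.FP.NestedStepLawTorusCompositeGenG

end
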